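import Literature.NumberTheory.EllipticCurves.OpenImageMazurCharacterProofs
import Literature.NumberTheory.GaloisRepresentations.SerreSubgroupsGL2Fp
import Literature.NumberTheory.GaloisRepresentations.DegreeOnePrimesFixedField
import HarnessLib

/-!
# Semistable mod-`p` images: the abelian toolkit (characters of `Γ_ℚ` unramified outside `p`,
# abelian quotients of `p`-groups, abelian subgroups of `GL₂(𝔽_p)` containing a complex conjugation)

`Proofs` file (theorems only, no definitions, no named facts), topic `NumberTheory/EllipticCurves`,
first sibling of `SemistableModPImage.lean` on the way to the named fact
`Literature.NumberTheory.EllipticCurves.Edixhoven1997_prop_2_1` (B. Edixhoven, *Serre's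
conjecture*, in Cornell–Silverman–Stevens 1997, Prop. 2.1, PDF p. 285 = J.-P. Serre, Invent.
Math. 15 (1972), §5.4, Prop. 21, plus Oesterlé's argument at `p = 2, 3, 5`).  The printed proof
uses three times the sentence "there is no Galois extension of `ℚ` of degree … unramified outside
`p`" (`p = 2`: cubic; `p = 3`: abelian of degree `4`; `p = 5`: cubic), and Serre's §5.4 uses
"`ℚ` n'admet pas d'extension non ramifiée de degré `> 1`".  In the tree these become statements
about homomorphisms `ψ : Γ_ℚ → M` (`M` commutative) with open kernel:

* `card_range_dvd_of_forall_inertia` — **if `ψ` is trivial on the inertia groups `I_𝔓 ≤ Γ_ℚ`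
  of all primes `𝔓` of `\bar ℤ` away from `p`, then `#ψ(Γ_ℚ) ∣ pᵉ (p - 1)` for some `e`**
  (the image is the image of one inertia group at `p` — "`ℚ` has no unramified extension", the
  tree's `Mazur1978.monoidHom_eq_one_of_forall_inertia` — which the Kronecker–Weber theorem
  (`Mazur1978.exists_comp_modNCyclotomicCharacter_eq`) maps through
  `ker((ℤ/m)ˣ → (ℤ/d)ˣ) ≅ (ℤ/pᵉ⁺¹)ˣ`, `m = pᵉ⁺¹ d`);
* `exists_normal_index_eq_sq_of_card_eq_prime_pow` — a group of order `pⁿ`, `n ≥ 2`, has a normal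
  subgroup of index `p²` with abelian quotient (centre and induction; groups of order `p²` are
  abelian);
* `Serre1972.exists_le_eigenvectorStabilizer_of_comm` — an abelian subgroup of `GL₂(𝔽_p)`, `p`
  odd, containing an element `c` with `c² = 1`, `det c = -1` ("complex conjugation", Serre 1972
  §5.2 (iv)) fixes a line (the `1`-eigenline of `c`).

## References

* [Edixhoven1997] B. Edixhoven, *Serre's conjecture*, in *Modular Forms and Fermat's Last
  Theorem* (Cornell, Silverman, Stevens eds.), Springer 1997, Prop. 2.1 and its proof (PDF
  pp. 285–286).
* [Serre1972] J.-P. Serre, *Propriétés galoisiennes des points d'ordre fini des courbes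
  elliptiques*, Invent. Math. 15 (1972) 259–331, §5.4 (proof of Prop. 21), §5.2 (iv).
* [Mazur1978] B. Mazur, *Rational isogenies of prime degree*, Invent. Math. 44 (1978), §5
  (p. 152) (for the two Galois-character lemmas of the tree used here).
-/

section MatrixPart

open Matrix
open scoped MatrixGroups

/-! ### Abelian subgroups of `GL₂(𝔽_p)` containing a complex conjugation fix a line -/

namespace Literature.NumberTheory.GaloisRepresentations.Serre1972

variable {F : Type*} [Field F]

/-- A non-zero `2 × 2` matrix moves some vector to a non-zero vector. [folklore] -/
theorem exists_mulVec_ne_zero {N : Matrix (Fin 2) (Fin 2) F} (hN : N ≠ 0) :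
    ∃ w : Fin 2 → F, N *ᵥ w ≠ 0 := by
  by_contra hall
  push Not at hall
  apply hN
  ext i j
  have h1 := congrFun (hall (Pi.single j 1)) i
  rw [Matrix.mulVec_single, MulOpposite.op_one, one_smul] at h1
  simpa using h1

/-- **An abelian subgroup of `GL₂(F)` (`2 ≠ 0` in `F`) containing an element `c` with `c² = 1`,
`det c = -1` fixes a line** — the `1`-eigenline `F v` of `c` (`v = (c + 1) w ≠ 0`): every
`g` commuting with `c` maps it into `ker (c - 1)`, a line since `c ≠ 1`.  With `c` the image of
complex conjugation (Serre 1972, §5.2 (iv)), this is why an abelian mod-`p` image is reducible.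
[cite: Serre1972, §5.2 (iv) and §5.4] -/
theorem exists_le_eigenvectorStabilizer_of_comm (h2 : (2 : F) ≠ 0) {G : Subgroup (GL (Fin 2) F)}
    (hcomm : ∀ a ∈ G, ∀ b ∈ G, a * b = b * a) {c : GL (Fin 2) F} (hcG : c ∈ G) (hc : c * c = 1)
    (hdet : Matrix.det (c : Matrix (Fin 2) (Fin 2) F) = -1) :
    ∃ (v : Fin 2 → F) (hv : v ≠ 0), G ≤ eigenvectorStabilizer v hv := by
  set C : Matrix (Fin 2) (Fin 2) F := (c : Matrix (Fin 2) (Fin 2) F) with hCdef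
  have hC2 : C * C = 1 := by
    have := congrArg (fun g : GL (Fin 2) F ↦ (g : Matrix (Fin 2) (Fin 2) F)) hc
    simpa only [Units.val_mul, Units.val_one] using this
  -- `C ≠ -1` and `C ≠ 1` (determinant `-1 ≠ 1`)
  have hCne1 : C - 1 ≠ 0 := by
    intro h0
    have hC1 : C = 1 := sub_eq_zero.mp h0
    rw [hC1, Matrix.det_one] at hdet
    exact h2 (by linear_combination hdet)
  have hCne : C + 1 ≠ 0 := by
    intro h0
    have hC1 : C = -1 := eq_neg_of_add_eq_zero_left h0
    rw [hC1, Matrix.det_neg, Matrix.det_one, Fintype.card_fin] at hdet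
    norm_num at hdet
    exact h2 (by linear_combination hdet)
  obtain ⟨w, hw⟩ := exists_mulVec_ne_zero hCne
  set v : Fin 2 → F := (C + 1) *ᵥ w with hvdef
  have hCv : (C - 1) *ᵥ v = 0 := by
    rw [hvdef, Matrix.mulVec_mulVec, show (C - 1) * (C + 1) = C * C - 1 by noncomm_ring, hC2,
      sub_self, Matrix.zero_mulVec]
  refine ⟨v, hw, fun g hg ↦ ?_⟩
  rw [mem_eigenvectorStabilizer_iff]
  -- `g v` is again killed by `C - 1`
  have hgc : (g : Matrix (Fin 2) (Fin 2) F) * C = C * (g : Matrix (Fin 2) (Fin 2) F) := by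
    have := congrArg (fun x : GL (Fin 2) F ↦ (x : Matrix (Fin 2) (Fin 2) F)) (hcomm g hg c hcG)
    simpa only [Units.val_mul] using this
  have hCgv : (C - 1) *ᵥ ((g : Matrix (Fin 2) (Fin 2) F) *ᵥ v) = 0 := by
    rw [Matrix.mulVec_mulVec, show (C - 1) * (g : Matrix (Fin 2) (Fin 2) F) =
      (g : Matrix (Fin 2) (Fin 2) F) * (C - 1) by rw [sub_mul, mul_sub, hgc, mul_one, one_mul],
      ← Matrix.mulVec_mulVec, hCv, Matrix.mulVec_zero]
  obtain ⟨a, ha⟩ := exists_eq_smul_of_mulVec_eq_zero hCne1 hw hCv hCgv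
  exact ⟨a, ha⟩

end Literature.NumberTheory.GaloisRepresentations.Serre1972

end MatrixPart

noncomputable section

open scoped Classical
open NumberField IsDedekindDomain IsDedekindDomain.HeightOneSpectrum Field
  Literature.NumberTheory.GaloisRepresentations

namespace Literature.NumberTheory.EllipticCurves

/-! ### Characters of `Γ_ℚ` unramified outside one prime -/

/-- The finite place of `ℚ` containing the prime `p` is the place of `p`. [folklore] -/
theorem heightOneSpectrum_eq_of_natCast_mem {p : ℕ} (hp : p.Prime) {v w : HeightOneSpectrum (𝓞 ℚ)}
    (hv : (p : 𝓞 ℚ) ∈ v.asIdeal) (hw : (p : 𝓞 ℚ) ∈ w.asIdeal) : v = w := by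
  apply Rat.HeightOneSpectrum.primesEquiv.injective
  apply Subtype.ext
  rw [primesEquiv_eq_of_natCast_mem hp hv, primesEquiv_eq_of_natCast_mem hp hw]

/-- **The image of a character of `Γ_ℚ` unramified outside `p` is the image of an inertia group
at `p`.**  Let `ψ : Γ_ℚ → M` (`M` commutative) have open kernel and be trivial on the inertia
groups `I_𝔓` of the primes `𝔓` of `\bar ℤ` not above `p`; then for any prime `𝔓₀ ∣ p`,
`ψ(Γ_ℚ) = ψ(I_{𝔓₀})`: the character `Γ_ℚ → M/ψ(I_{𝔓₀})` is trivial on every inertia group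
(those above `p` are conjugate to `I_{𝔓₀}`), hence trivial — "`ℚ` n'admet pas d'extension non
ramifiée de degré `> 1`" (Serre 1972, §5.4; the tree's
`Mazur1978.monoidHom_eq_one_of_forall_inertia`, Minkowski). [cite: Serre1972, §5.4, proof of Prop. 21 ii)] -/
theorem range_le_map_inertia_of_forall_inertia {M : Type*} [CommGroup M] {p : ℕ} (hp : p.Prime)
    (ψ : absoluteGaloisGroup ℚ →* M)
    (hker : IsOpen ((ψ.ker : Subgroup (absoluteGaloisGroup ℚ)) : Set (absoluteGaloisGroup ℚ)))
    (h : ∀ v : HeightOneSpectrum (𝓞 ℚ), (p : 𝓞 ℚ) ∉ v.asIdeal → ∀ 𝔓 ∈ v.primesAbove,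
      ∀ τ ∈ 𝔓.inertia (absoluteGaloisGroup ℚ), ψ τ = 1)
    {v₀ : HeightOneSpectrum (𝓞 ℚ)} (hv₀ : (p : 𝓞 ℚ) ∈ v₀.asIdeal)
    {𝔓₀ : Ideal (absIntegers (𝓞 ℚ) ℚ)} (h𝔓₀ : 𝔓₀ ∈ v₀.primesAbove) :
    ψ.range ≤ (𝔓₀.inertia (absoluteGaloisGroup ℚ)).map ψ := by
  set H : Subgroup M := (𝔓₀.inertia (absoluteGaloisGroup ℚ)).map ψ with hH
  set ψ' : absoluteGaloisGroup ℚ →* M ⧸ H := (QuotientGroup.mk' H).comp ψ with hψ'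
  have hker' : IsOpen ((ψ'.ker : Subgroup (absoluteGaloisGroup ℚ)) : Set (absoluteGaloisGroup ℚ)) := by
    refine Subgroup.isOpen_mono ?_ hker
    intro σ hσ
    rw [MonoidHom.mem_ker] at hσ ⊢
    rw [hψ', MonoidHom.comp_apply, hσ, map_one]
  have htriv : ψ' = 1 := by
    refine Mazur1978.monoidHom_eq_one_of_forall_inertia ψ' hker' fun v 𝔓 h𝔓 τ hτ ↦ ?_
    rw [hψ', MonoidHom.comp_apply, QuotientGroup.mk'_apply, QuotientGroup.eq_one_iff]
    by_cases hv : (p : 𝓞 ℚ) ∈ v.asIdeal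
    · -- a prime above `p`: conjugate to `𝔓₀`
      have hvv₀ : v = v₀ := heightOneSpectrum_eq_of_natCast_mem hp hv hv₀
      subst hvv₀
      obtain ⟨g, hg⟩ := HeightOneSpectrum.exists_smul_eq_of_mem_primesAbove_holds (K := ℚ) h𝔓₀ h𝔓
      rw [← hg] at hτ
      have hσ : g⁻¹ * τ * g ∈ 𝔓₀.inertia (absoluteGaloisGroup ℚ) :=
        DegreeOnePrimes.conj_mem_inertia_of_mem_inertia_smul hτ
      have hval : ψ τ = ψ (g⁻¹ * τ * g) := by
        rw [map_mul, map_mul, map_inv, mul_comm (ψ g)⁻¹, mul_assoc, inv_mul_cancel, mul_one]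
      rw [hval]
      exact Subgroup.mem_map_of_mem ψ hσ
    · rw [h v hv 𝔓 h𝔓 τ hτ]
      exact H.one_mem
  rintro x ⟨σ, rfl⟩
  have h1 : ψ' σ = 1 := by rw [htriv, MonoidHom.one_apply]
  rwa [hψ', MonoidHom.comp_apply, QuotientGroup.mk'_apply, QuotientGroup.eq_one_iff] at h1

/-- **A character of `Γ_ℚ` unramified outside `p` has image of order dividing `pᵉ (p - 1)`.**
For `ψ : Γ_ℚ → M` (`M` commutative) with open kernel, trivial on the inertia groups of all primes
of `\bar ℤ` not above the prime `p`, there is `e` with `#ψ(Γ_ℚ) ∣ pᵉ (p - 1)`.  Proof: the image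
is `ψ(I_{𝔓₀})` (`range_le_map_inertia_of_forall_inertia`); by Kronecker–Weber `ψ = β ∘ χ_m`
(`Mazur1978.exists_comp_modNCyclotomicCharacter_eq`), and with `m = pᵏ d`, `p ∤ d`, the
cyclotomic character `χ_m` maps `I_{𝔓₀}` into `ker((ℤ/m)ˣ → (ℤ/d)ˣ)`, of order `φ(pᵏ)`
(`χ_d` is unramified at `p`).  This is the form in which the tree uses "there is no Galois
extension of `ℚ` of degree `3` ramified only at `2`", "no abelian extension of degree `4`
unramified outside `3`", "no cubic Galois extension unramified outside `5`" (Edixhoven 1997,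
proof of Prop. 2.1: such fields would lie in `ℚ(ζ_{pᵏ})`).
[cite: Edixhoven1997, proof of Prop. 2.1 (PDF pp. 285–286)] -/
theorem card_range_dvd_of_forall_inertia {M : Type*} [CommGroup M] {p : ℕ} (hp : p.Prime)
    (ψ : absoluteGaloisGroup ℚ →* M)
    (hker : IsOpen ((ψ.ker : Subgroup (absoluteGaloisGroup ℚ)) : Set (absoluteGaloisGroup ℚ)))
    (h : ∀ v : HeightOneSpectrum (𝓞 ℚ), (p : 𝓞 ℚ) ∉ v.asIdeal → ∀ 𝔓 ∈ v.primesAbove,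
      ∀ τ ∈ 𝔓.inertia (absoluteGaloisGroup ℚ), ψ τ = 1) :
    ∃ e : ℕ, Nat.card ψ.range ∣ p ^ e * (p - 1) := by
  haveI : Fact p.Prime := ⟨hp⟩
  haveI : NeZero p := ⟨hp.ne_zero⟩
  -- the place of `ℚ` at `p` and a prime of `\bar ℤ` above it
  set vp : HeightOneSpectrum (𝓞 ℚ) := Rat.HeightOneSpectrum.primesEquiv.symm ⟨p, hp⟩ with hvpdef
  have hgen : Rat.HeightOneSpectrum.natGenerator vp = p := by
    change ((Rat.HeightOneSpectrum.primesEquiv vp : Nat.Primes) : ℕ) = p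
    rw [hvpdef, Equiv.apply_symm_apply]
  have hvp : (p : 𝓞 ℚ) ∈ vp.asIdeal := by
    have h1 := Mazur1978.natCast_natGenerator_mem_asIdeal vp
    rwa [hgen] at h1
  obtain ⟨𝔓₀, h𝔓₀⟩ := HeightOneSpectrum.primesAbove_nonempty vp
  haveI := h𝔓₀.1
  have hrange := range_le_map_inertia_of_forall_inertia hp ψ hker h hvp h𝔓₀
  -- Kronecker–Weber: `ψ = β ∘ χ_m`, `m = p^k d`, `p ∤ d`
  obtain ⟨m, _, β, hβ⟩ := Mazur1978.exists_comp_modNCyclotomicCharacter_eq ψ hker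
  obtain ⟨k, d, hd, hm⟩ := Nat.exists_eq_pow_mul_and_not_dvd (NeZero.ne m) p hp.one_lt.ne'
  haveI : NeZero d := ⟨fun h0 ↦ NeZero.ne m (by rw [hm, h0, mul_zero])⟩
  have hdm : d ∣ m := ⟨p ^ k, by rw [hm, mul_comm]⟩
  -- `χ_m(I_{𝔓₀}) ⊆ K := ker ((ℤ/m)ˣ → (ℤ/d)ˣ)` (`χ_d` is unramified at `p`)
  set K : Subgroup (ZMod m)ˣ := (ZMod.unitsMap hdm).ker with hKdef
  have hmemK : ∀ τ ∈ 𝔓₀.inertia (absoluteGaloisGroup ℚ), modNCyclotomicCharacter ℚ m τ ∈ K := by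
    intro τ hτ
    rw [hKdef, MonoidHom.mem_ker, Mazur1978.unitsMap_modNCyclotomicCharacter hdm]
    refine modNCyclotomicCharacter_eq_one_of_mem_inertia
      (Rat.natCast_not_mem_of_mem_primesAbove_of_not_dvd h𝔓₀ ?_) hτ
    rw [primesEquiv_eq_of_natCast_mem hp hvp]
    exact hd
  -- hence `ψ(Γ_ℚ) = ψ(I_{𝔓₀}) ≤ β(K)`
  have hle : ψ.range ≤ K.map β := by
    refine hrange.trans ?_
    rintro x ⟨τ, hτ, rfl⟩
    exact ⟨modNCyclotomicCharacter ℚ m τ, hmemK τ hτ, hβ τ⟩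
  -- `#K = φ(m)/φ(d) = φ(p^k)`
  have hcardK : Nat.card K * Nat.totient d = Nat.totient m := by
    have h1 := Subgroup.card_mul_index (ZMod.unitsMap hdm).ker
    rwa [Subgroup.index_ker, MonoidHom.range_eq_top.mpr (ZMod.unitsMap_surjective hdm),
      Subgroup.card_top, Nat.card_eq_fintype_card (α := (ZMod d)ˣ), ZMod.card_units_eq_totient,
      Nat.card_eq_fintype_card (α := (ZMod m)ˣ), ZMod.card_units_eq_totient] at h1
  have hφm : Nat.totient m = Nat.totient (p ^ k) * Nat.totient d := by
    rw [hm, Nat.totient_mul ((Nat.Coprime.pow_left _ ((Nat.Prime.coprime_iff_not_dvd hp).mpr hd)))]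
  have hcardK' : Nat.card K = Nat.totient (p ^ k) := by
    rw [hφm] at hcardK
    exact Nat.eq_of_mul_eq_mul_right (Nat.totient_pos.mpr (NeZero.pos d)) hcardK
  have hdvd : Nat.card ψ.range ∣ Nat.totient (p ^ k) := by
    rw [← hcardK']
    exact (Subgroup.card_dvd_of_le hle).trans (K.card_map_dvd β)
  rcases Nat.eq_zero_or_pos k with hk | hk
  · refine ⟨0, ?_⟩
    rw [hk, pow_zero, Nat.totient_one] at hdvd
    rw [pow_zero, one_mul, Nat.dvd_one.mp hdvd]
    exact one_dvd _
  · obtain ⟨e, rfl⟩ : ∃ e, k = e + 1 := ⟨k - 1, by omega⟩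
    refine ⟨e, ?_⟩
    rwa [Nat.totient_prime_pow_succ hp] at hdvd

/-! ### Abelian quotients of `p`-groups -/

/-- **A group of order `pⁿ`, `n ≥ 2`, has a normal subgroup of index `p²` with abelian
quotient** (a non-trivial `p`-group has non-trivial centre; if `G/Z(G)` has order `≤ p` it is
cyclic and `G` is abelian, and an abelian group of order `pⁿ` has a subgroup of order `pⁿ⁻²`;
otherwise induct on `G/Z(G)`; groups of order `p²` are abelian).  Used at `p = 3` of Edixhoven
1997, Prop. 2.1: "then `G` has a quotient of order `4`". [folklore] -/
theorem exists_normal_index_eq_sq_of_card_eq_prime_pow {p : ℕ} [hp : Fact p.Prime] :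
    ∀ (n : ℕ) (G : Type*) [Group G] [Finite G], Nat.card G = p ^ n → 2 ≤ n →
      ∃ N : Subgroup G, N.Normal ∧ N.index = p ^ 2 ∧ ∀ a b : G, a * b * a⁻¹ * b⁻¹ ∈ N := by
  intro n
  induction n using Nat.strong_induction_on with
  | _ n ih =>
    intro G _ _ hG hn
    have hPG : IsPGroup p G := IsPGroup.of_card hG
    -- abelian case: a subgroup of order `p^(n-2)`
    by_cases hcomm : ∀ a b : G, a * b = b * a
    · obtain ⟨N, hN⟩ := Sylow.exists_subgroup_card_pow_prime p (n := n - 2)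
        (show p ^ (n - 2) ∣ Nat.card G from hG ▸ pow_dvd_pow p (by omega))
      haveI hNn : N.Normal := ⟨fun a ha g ↦ by rwa [hcomm g a, mul_inv_cancel_right]⟩
      refine ⟨N, hNn, ?_, fun a b ↦ ?_⟩
      · have h1 := Subgroup.card_mul_index N
        rw [hN, hG] at h1
        have h2 : p ^ (n - 2) * p ^ 2 = p ^ n := by rw [← pow_add]; congr 1; omega
        rw [← h2] at h1
        exact Nat.eq_of_mul_eq_mul_left (pow_pos hp.out.pos _) h1
      · rw [hcomm a b, mul_inv_cancel_right, mul_inv_cancel]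
        exact N.one_mem
    · -- non-abelian: quotient by the (non-trivial) centre and induct
      haveI : Nontrivial G := by
        rw [← Finite.one_lt_card_iff_nontrivial, hG]
        exact Nat.one_lt_pow (by omega) hp.out.one_lt
      have hZ : Nontrivial (Subgroup.center G) := hPG.center_nontrivial
      set Z := Subgroup.center G with hZdef
      obtain ⟨j, hj⟩ := IsPGroup.iff_card.mp (hPG.to_subgroup Z)
      have hj1 : 1 ≤ j := by
        by_contra h0
        push Not at h0
        have : j = 0 := by omega
        rw [this, pow_zero] at hj
        exact (Finite.one_lt_card_iff_nontrivial.mpr hZ).ne' hj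
      obtain ⟨k, hk⟩ := IsPGroup.iff_card.mp (hPG.to_quotient Z)
      have hkj : k + j = n := by
        have h1 := Subgroup.card_eq_card_quotient_mul_card_subgroup Z
        rw [hG, hj, hk, ← pow_add] at h1
        exact (Nat.pow_right_injective hp.out.two_le h1).symm
      -- `G/Z` is not cyclic (else `G` abelian), so `k ≥ 2`
      have hk2 : 2 ≤ k := by
        by_contra hlt
        push Not at hlt
        have hcyc : IsCyclic (G ⧸ Z) := by
          rcases Nat.lt_or_ge k 1 with h0 | h1
          · have : k = 0 := by omega
            rw [this, pow_zero] at hk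
            haveI : Subsingleton (G ⧸ Z) := (Nat.card_eq_one_iff_unique.mp hk).1
            infer_instance
          · have : k = 1 := by omega
            rw [this, pow_one] at hk
            exact isCyclic_of_prime_card hk
        apply hcomm
        intro a b
        haveI := MonoidHom.isMulCommutative_of_isCyclic_of_ker_le_center (QuotientGroup.mk' Z) (by
          rw [QuotientGroup.ker_mk'])
        exact IsMulCommutative.is_comm.comm a b
      obtain ⟨N', hN'n, hN'i, hN'c⟩ := ih k (by omega) (G ⧸ Z) hk hk2
      refine ⟨N'.comap (QuotientGroup.mk' Z), hN'n.comap _, ?_, fun a b ↦ ?_⟩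
      · rw [Subgroup.index_comap_of_surjective _ (QuotientGroup.mk'_surjective Z), hN'i]
      · rw [Subgroup.mem_comap, map_mul, map_mul, map_mul, map_inv, map_inv]
        exact hN'c _ _

end Literature.NumberTheory.EllipticCurves

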